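/-
Origin: expansion seat `prover-pub-hodgecm-mc-sinst-1-g3-0`, handover #1212 2026-08-20T05:22Z md5 bf7f564b04bb (193 l.) NEW additive drop-alone leaf after RUN-41 #1208 #1209 (sinst-1) + #CA16 ArchKTypeOfOrient (carch-1); the assembled (J-μ-pin) S family: SInstance.SR (generic guard G/hG; inputs hGR×5, χV, μ, guarded hpos, guarded hΔ₁ hΔ₂ hΔ₃; η := EtaChi.η χV (χOfType nW), hμ₀ discharged by the slot-0 normalisation nW := nWOf) and SInstance.SROG (OG guard (mk ι₁).embedding = ι₁ ∧ GoodCtx (orientBitι L ι₁) ι₁ c: hG and hpos₀..₃ discharged; inputs hGR×5, χV, μ + hΔ₁ hΔ₂ hΔ₃ only) with hT_R/hT_ROG (row 13) and hLF_R/hLF_ROG hypothesis-free, SR_eq_archSideOf read-back; install AFTER #1208 #1209 #CA16; drop alone on bounce; NAME LIST: HodgeCM.Model.SInstance.nW · HodgeCM.Model.SInstance.nW_apply · HodgeCM.Model.SInstance.χWR · HodgeCM.Model.SInstance.archType_χOfType_nW · HodgeCM.Model.SInstance.AR · HodgeCM.Model.SInstance.SR · HodgeCM.Model.SInstance.hT_R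 · HodgeCM.Model.SInstance.hLF_R · HodgeCM.Model.SInstance.SR_eq_archSideOf · HodgeCM.Model.SInstance.GOG · HodgeCM.Model.SInstance.hG_GOG · HodgeCM.Model.SInstance.hpos_GOG · HodgeCM.Model.SInstance.SROG · HodgeCM.Model.SInstance.hT_ROG · HodgeCM.Model.SInstance.hLF_ROG (`HOME/mc/pub-hodgecm-mc-sinst-1-g3/stage/HodgeCM/Model/ThetaAdelicSideReadOff.lean`, md5 bf7f564b04bb, 193 lines);
landed by the second packager p2 gen 3 (p2-g3) in gate run 42 as `HodgeCM/Model/ThetaAdelicSideReadOff.lean` (verbatim).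
-/
/-
Origin: speedrun cell pub-hodgecm, MODEL-CONSTRUCTION sub-cell, lineage mc-sinst-1 (S-instance constructor, BINDER-OWNERS row 5 `S` + row 13 `hT`),
seat prover-pub-hodgecm-mc-sinst-1-g3-0 (gen 3), 2026-08-20.  Target in PKG: `HodgeCM/Model/ThetaAdelicSideReadOff.lean`
(NEW additive drop-alone leaf; RUN 42 material; imports `Model/ThetaAdelicSideGuardedP` (#1209) + `Model/ArchLineSlotTypeCont` (#1208) + `Model/ArchKTypeOfOrient` ((U3), installed RUN 40)).
KERNEL only: 0 records / `def … : Prop` / cites, 0 proof holes; intended closure {propext, Classical.choice, Quot.sound}.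
-/
import Summits.HodgeConjecture.HodgeCM.Model.ThetaAdelicSideGuardedP
import Summits.HodgeConjecture.HodgeCM.Model.ArchLineSlotTypeCont_2
import Summits.HodgeConjecture.HodgeCM.Model.ArchKTypeOfOrient

/-!
# THE ROW-5 PIN UNDER (J-μ-pin): the guarded S family whose datum is (F1)'s read-off datum — the ASSEMBLED term E writes

With the predicate-guarded family `SInstance.SGP` (#1209) and the read-off datum `archLineDatumOfReadOff` (#1208), this leaf assembles
the S pin of the honest end state as ONE family term over E-level ∀ {L : CMField} {ι₁ : L →+* ℂ} (V : HermSpace3 L ι₁) (c : SeesawCtx L)ILY inputs only: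

  `SInstance.SR @G @hG @hGR @χV @hGR₀ @hGR₁ @hGR₂ @hGR₃ @μ @hpos @hΔ₁ @hΔ₂ @hΔ₃ : ∀ {L ι₁} V c, ThetaAdelicSide V c`

* `G`/`hG` — the guard of record and its plane-definiteness consequence (#1209 `hG_goodCtx/O/OG`);
* `hGR×5` — [GR91 3.1.1] (cited, as before); `χV` — the V-character family (data); `μ` — E's V-free weight table (data);
* `hpos` — the four slot positivity facts UNDER the guard (theorems at the oriented guard: (F2)/(U3) `hposₖ_of_orient…`);
* `hΔ₁ hΔ₂ hΔ₃` — the three GUARDED integer identities `slotTypeVec k − slotTypeVec 0 = μ c k − μ c 0` ((J-μ) residual; binder-2/theta closed forms).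
NO `η`, `hη`, `hηc`, `𝔄`, `hμ₀` inputs: `η := EtaChi.η χV χWR`, `χWR := EtaChi.χOfType nW`, with the slot-0 normalisation `nW := nWOf`-family
(#1207/#1208), `hμ₀` discharged (`archType_χOfType` + `nWOf_eq`).  `SInstance.hT_R` = row 13 at this pin, hypothesis-free (#1209 `hT_P`).
Nothing here is a claim of PerL/QW8; nothing is cited as a fact.
-/

set_option autoImplicit false

noncomputable section

open scoped Matrix Classical
open Literature.NumberTheory.Automorphic Literature.NumberTheory.Weil1964
open Literature.NumberTheory.GelbartRogawski1991.UnitaryDualPair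
open HodgeCM.Adelic HodgeCM.PerL34

namespace HodgeCM.Model.SInstance

open HodgeCM.Model.ArchSideTerm

variable
  (G : ∀ {L : CMField} {ι₁ : L →+* ℂ} (_V : HermSpace3 L ι₁) (_c : SeesawCtx L), Prop)
  (hG : ∀ {L : CMField} {ι₁ : L →+* ℂ} (V : HermSpace3 L ι₁) (c : SeesawCtx L), G V c → (∀ j, 0 < (ι₁ (dW c.D j)).re) ∨ ∀ j, (ι₁ (dW c.D j)).re < 0)
  (hGR : ∀ {L : CMField} {ι₁ : L →+* ℂ} (V : HermSpace3 L ι₁) (c : SeesawCtx L),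
    (cmSplittingDatum (L : Type) finProdFinEquiv (frameD V) (frameD_real V) (frameD_ne V) (dW c.D) (dW_real c.D)
      (dW_ne c.D)).CompatibleSplitting)
  (χV : ∀ {L : CMField} {ι₁ : L →+* ℂ} (_V : HermSpace3 L ι₁) (_c : SeesawCtx L),
    ContinuousMonoidHom (relNormOneIdeles (↥(NumberField.maximalRealSubfield (L : Type))) (L : Type) ⧸
      relNormOneRat (↥(NumberField.maximalRealSubfield (L : Type))) (L : Type)) Circle)
  (hGR₀ : ∀ {L : CMField} {ι₁ : L →+* ℂ} (V : HermSpace3 L ι₁) (c : SeesawCtx L),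
    (cmSplittingDatum (L : Type) (e₁) (frameD V) (frameD_real V) (frameD_ne V) (lineVec (L : Type) (dW c.D 0))
      (fun _ => dW_real c.D 0) (fun _ => dW_ne c.D 0)).CompatibleSplitting)
  (hGR₁ : ∀ {L : CMField} {ι₁ : L →+* ℂ} (V : HermSpace3 L ι₁) (c : SeesawCtx L),
    (cmSplittingDatum (L : Type) (e₁) (frameD V) (frameD_real V) (frameD_ne V) (lineVec (L : Type) (dW c.D 1))
      (fun _ => dW_real c.D 1) (fun _ => dW_ne c.D 1)).CompatibleSplitting)
  (hGR₂ : ∀ {L : CMField} {ι₁ : L →+* ℂ} (V : HermSpace3 L ι₁) (c : SeesawCtx L),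
    (cmSplittingDatum (L : Type) (e₁) (frameD V) (frameD_real V) (frameD_ne V) (lineVec (L : Type) (dW' c.D 0))
      (fun _ => dW'_real c.D 0) (fun _ => dW'_ne c.D 0)).CompatibleSplitting)
  (hGR₃ : ∀ {L : CMField} {ι₁ : L →+* ℂ} (V : HermSpace3 L ι₁) (c : SeesawCtx L),
    (cmSplittingDatum (L : Type) (e₁) (frameD V) (frameD_real V) (frameD_ne V) (lineVec (L : Type) (dW' c.D 1))
      (fun _ => dW'_real c.D 1) (fun _ => dW'_ne c.D 1)).CompatibleSplitting)
  (μ : ∀ {L : CMField}, SeesawCtx L → Fin 4 → NumberField.InfinitePlace (L : Type) → ℤ)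
  (hpos : ∀ {L : CMField} {ι₁ : L →+* ℂ} (V : HermSpace3 L ι₁) (c : SeesawCtx L), G V c →
    0 < HypCensus.cmXW (L : Type) (frameD V) (lineVec (L : Type) (dW c.D 0)) (fun _ => dW_real c.D 0) ι₁ (HypCensus.cmPlace (L : Type) ι₁) 0 ∧
    0 < HypCensus.cmXW (L : Type) (frameD V) (lineVec (L : Type) (dW c.D 1)) (fun _ => dW_real c.D 1) ι₁ (HypCensus.cmPlace (L : Type) ι₁) 0 ∧
    0 < HypCensus.cmXW (L : Type) (frameD V) (lineVec (L : Type) (dW' c.D 0)) (fun _ => dW'_real c.D 0) ι₁ (HypCensus.cmPlace (L : Type) ι₁) 0 ∧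
    0 < HypCensus.cmXW (L : Type) (frameD V) (lineVec (L : Type) (dW' c.D 1)) (fun _ => dW'_real c.D 1) ι₁ (HypCensus.cmPlace (L : Type) ι₁) 0)

/-- **the W-character type family of the slot-0 normalisation**: `nW V c = μ c 0 − slotType₀` under plane-definiteness, `0` else. -/
def nW : ∀ {L : CMField} {ι₁ : L →+* ℂ} (_V : HermSpace3 L ι₁) (_c : SeesawCtx L), NumberField.InfinitePlace (L : Type) → ℤ :=
  fun V c => nWOf V c (hGR V c) (hGR₀ V c) (hGR₁ V c) (lineCHom V (dW c.D 0) (dW_real c.D 0) (dW_ne c.D 0) (hGR₀ V c)) (μ c 0)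

/-- unfolding of `nW`. -/
theorem nW_apply {L : CMField} {ι₁ : L →+* ℂ} (V : HermSpace3 L ι₁) (c : SeesawCtx L) :
    nW @hGR @hGR₀ @hGR₁ @μ V c = nWOf V c (hGR V c) (hGR₀ V c) (hGR₁ V c) (lineCHom V (dW c.D 0) (dW_real c.D 0) (dW_ne c.D 0) (hGR₀ V c)) (μ c 0) :=
  rfl

/-- **the W-character family of the slot-0 normalisation**: `χWR V c := EtaChi.χOfType nW V c` (Hecke character of `U(1)` of
archimedean type `nW V c`, chosen by (K-char) `exists_char_of_archType` inside `EtaChi.χOfType`). -/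
abbrev χWR : ∀ {L : CMField} {ι₁ : L →+* ℂ} (_V : HermSpace3 L ι₁) (_c : SeesawCtx L),
    ContinuousMonoidHom (relNormOneIdeles (↥(NumberField.maximalRealSubfield (L : Type))) (L : Type) ⧸
      relNormOneRat (↥(NumberField.maximalRealSubfield (L : Type))) (L : Type)) Circle :=
  @EtaChi.χOfType (@nW @hGR @hGR₀ @hGR₁ @μ)

/-- under the guard, the chosen W-character `χOfType nW` HAS the slot-0 type `μ c 0 − slotTypeVec 0`. -/
theorem archType_χOfType_nW {L : CMField} {ι₁ : L →+* ℂ} (V : HermSpace3 L ι₁) (c : SeesawCtx L) (hc : G V c) :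
    UnitaryLineChar.archType (L : Type) (χWR @hGR @hGR₀ @hGR₁ @μ V c) =
      μ c 0 - slotTypeVec V c (hGR V c) (hGR₀ V c) (hGR₁ V c) (hGR₂ V c) (hGR₃ V c) (hG V c hc) 0 := by
  rw [χWR, archType_χOfType]
  exact nWOf_eq V c (hGR V c) (hGR₀ V c) (hGR₁ V c) _ (continuous_slotChi₀_mul_lineCHom V c.D (hGR V c) (hGR₀ V c) (hGR₁ V c) (hG V c hc)) (μ c 0)

variable
  (hΔ₁ : ∀ {L : CMField} {ι₁ : L →+* ℂ} (V : HermSpace3 L ι₁) (c : SeesawCtx L), ∀ hc : G V c,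
    slotTypeVec V c (hGR V c) (hGR₀ V c) (hGR₁ V c) (hGR₂ V c) (hGR₃ V c) (hG V c hc) 1 -
      slotTypeVec V c (hGR V c) (hGR₀ V c) (hGR₁ V c) (hGR₂ V c) (hGR₃ V c) (hG V c hc) 0 = μ c 1 - μ c 0)
  (hΔ₂ : ∀ {L : CMField} {ι₁ : L →+* ℂ} (V : HermSpace3 L ι₁) (c : SeesawCtx L), ∀ hc : G V c,
    slotTypeVec V c (hGR V c) (hGR₀ V c) (hGR₁ V c) (hGR₂ V c) (hGR₃ V c) (hG V c hc) 2 -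
      slotTypeVec V c (hGR V c) (hGR₀ V c) (hGR₁ V c) (hGR₂ V c) (hGR₃ V c) (hG V c hc) 0 = μ c 2 - μ c 0)
  (hΔ₃ : ∀ {L : CMField} {ι₁ : L →+* ℂ} (V : HermSpace3 L ι₁) (c : SeesawCtx L), ∀ hc : G V c,
    slotTypeVec V c (hGR V c) (hGR₀ V c) (hGR₁ V c) (hGR₂ V c) (hGR₃ V c) (hG V c hc) 3 -
      slotTypeVec V c (hGR V c) (hGR₀ V c) (hGR₁ V c) (hGR₂ V c) (hGR₃ V c) (hG V c hc) 0 = μ c 3 - μ c 0)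

/-- **the guarded archimedean line inputs from the read-off datum** (`AG` of `SGP`). -/
def AR : ∀ {L : CMField} {ι₁ : L →+* ℂ} (V : HermSpace3 L ι₁) (c : SeesawCtx L), G V c → ∀ k : Fin 4,
    ArchLineInput V (lineRepD V c.D (hGR V c) (hGR₀ V c) (hGR₁ V c) (hGR₂ V c) (hGR₃ V c)
      (EtaChi.η @χV (@χWR @hGR @hGR₀ @hGR₁ @μ) V c) k) :=
  fun V c hc k => archLineInputOf
    (archLineDatumOfReadOff χV (@χWR @hGR @hGR₀ @hGR₁ @μ) V c (hGR V c) (hGR₀ V c) (hGR₁ V c) (hGR₂ V c) (hGR₃ V c) (μ c)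
      (hpos V c hc).1 (hpos V c hc).2.1 (hpos V c hc).2.2.1 (hpos V c hc).2.2.2 (hG V c hc)
      (archType_χOfType_nW @G @hG @hGR @hGR₀ @hGR₁ @hGR₂ @hGR₃ @μ V c hc) (hΔ₁ V c hc) (hΔ₂ V c hc) (hΔ₃ V c hc)) k

/-- **THE ROW-5 PIN UNDER (J-μ-pin)**: the guarded total S family at the read-off datum — E-level inputs `G hG hGR χV hGR₀..₃ μ hpos hΔ₁ hΔ₂ hΔ₃` only. -/
abbrev SR : ∀ {L : CMField} {ι₁ : L →+* ℂ} (V : HermSpace3 L ι₁) (c : SeesawCtx L), ThetaAdelicSide V c :=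
  SGP @G @hG @hGR (@EtaChi.η @χV (@χWR @hGR @hGR₀ @hGR₁ @μ))
    (@EtaChi.hη @χV (@χWR @hGR @hGR₀ @hGR₁ @μ))
    (@EtaChi.hηc @χV (@χWR @hGR @hGR₀ @hGR₁ @μ)) @hGR₀ @hGR₁ @hGR₂ @hGR₃
    (@AR @G @hG @hGR @χV @hGR₀ @hGR₁ @hGR₂ @hGR₃ @μ @hpos @hΔ₁ @hΔ₂ @hΔ₃)

/-- **row 13 `hT` at the (J-μ-pin) S pin, hypothesis-free.** -/
theorem hT_R : ∀ {L : CMField} {ι₁ : L →+* ℂ} (V : HermSpace3 L ι₁) (c : SeesawCtx L) (k : Fin 4) (N : ℕ),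
    ((SR @G @hG @hGR @χV @hGR₀ @hGR₁ @hGR₂ @hGR₃ @μ @hpos @hΔ₁ @hΔ₂ @hΔ₃ V c).P k).IsThetaArchContinuous N :=
  hT_P _ _ _ _ _ _ _ _ _ _ _

/-- `hLF` at the (J-μ-pin) S pin, hypothesis-free. -/
theorem hLF_R : ∀ {L : CMField} {ι₁ : L →+* ℂ} (V : HermSpace3 L ι₁) (c : SeesawCtx L) (k : Fin 4),
    ((SR @G @hG @hGR @χV @hGR₀ @hGR₁ @hGR₂ @hGR₃ @μ @hpos @hΔ₁ @hΔ₂ @hΔ₃ V c).P k).IsLFAction :=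
  hLF_P _ _ _ _ _ _ _ _ _ _ _

/-- under the guard the pin IS period-1's term at the read-off datum (read-backs via #1209 `SGP_eq_archSideOf` / `thetaAdelicSideOfP_*`). -/
theorem SR_eq_archSideOf {L : CMField} {ι₁ : L →+* ℂ} (V : HermSpace3 L ι₁) (c : SeesawCtx L) (hc : G V c) :
    SR @G @hG @hGR @χV @hGR₀ @hGR₁ @hGR₂ @hGR₃ @μ @hpos @hΔ₁ @hΔ₂ @hΔ₃ V c =
      archSideOf V c (hGR V c) (hGR₀ V c) (hGR₁ V c) (hGR₂ V c) (hGR₃ V c)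
        (EtaChi.η @χV (@χWR @hGR @hGR₀ @hGR₁ @μ) V c)
        (EtaChi.hη @χV (@χWR @hGR @hGR₀ @hGR₁ @μ) V c)
        (EtaChi.hηc @χV (@χWR @hGR @hGR₀ @hGR₁ @μ) V c) (hG V c hc)
        (AR @G @hG @hGR @χV @hGR₀ @hGR₁ @hGR₂ @hGR₃ @μ @hpos @hΔ₁ @hΔ₂ @hΔ₃ V c hc) :=
  SGP_eq_archSideOf _ _ _ _ _ _ _ _ _ _ _ V c hc

/-! ## § 2 the pin at the guard of record `(mk ι₁).embedding = ι₁ ∧ GoodCtx (orientBitι L ι₁) ι₁ c` — `G`, `hG` AND `hpos` discharged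

At glue-1's OG guard (canonical representative + good context of the ORIENTED bit `orientBitι`, G1/G3) the four slot positivity
facts are theorems ((U3) `hpos_iff_eq_orientBitι_of_goodCtx_of_embedding_eq … .2 rfl`), so the pin's E-level inputs shrink to
`hGR×5, χV, μ` (cited ∕ data) and the three guarded integer identities `hΔ₁ hΔ₂ hΔ₃` ((J-μ) residual). -/

/-- **the OG guard family** of the `_r21AEOG` chain: canonical representative `(mk ι₁).embedding = ι₁` and a good context of the oriented bit. -/
abbrev GOG : ∀ {L : CMField} {ι₁ : L →+* ℂ} (_V : HermSpace3 L ι₁) (_c : SeesawCtx L), Prop :=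
  fun {L} {ι₁} _V c => (NumberField.InfinitePlace.mk ι₁).embedding = ι₁ ∧ SignRecipe.GoodCtx (orientBitι L ι₁) ι₁ c

/-- plane-definiteness at `ι₁` under the OG guard (#1209 `hG_goodCtxOG` at `hb := orientBitι`). -/
theorem hG_GOG : ∀ {L : CMField} {ι₁ : L →+* ℂ} (V : HermSpace3 L ι₁) (c : SeesawCtx L),
    GOG V c → (∀ j, 0 < (ι₁ (dW c.D j)).re) ∨ ∀ j, (ι₁ (dW c.D j)).re < 0 :=
  hG_goodCtxOG orientBitι

/-- **the four slot positivity facts HOLD under the OG guard** ((U3) `hpos_iff_eq_orientBitι_of_goodCtx_of_embedding_eq`, (F2) `hpos_iff_orient_of_goodCtx`). -/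
theorem hpos_GOG : ∀ {L : CMField} {ι₁ : L →+* ℂ} (V : HermSpace3 L ι₁) (c : SeesawCtx L), GOG V c →
    0 < HypCensus.cmXW (L : Type) (frameD V) (lineVec (L : Type) (dW c.D 0)) (fun _ => dW_real c.D 0) ι₁ (HypCensus.cmPlace (L : Type) ι₁) 0 ∧
    0 < HypCensus.cmXW (L : Type) (frameD V) (lineVec (L : Type) (dW c.D 1)) (fun _ => dW_real c.D 1) ι₁ (HypCensus.cmPlace (L : Type) ι₁) 0 ∧
    0 < HypCensus.cmXW (L : Type) (frameD V) (lineVec (L : Type) (dW' c.D 0)) (fun _ => dW'_real c.D 0) ι₁ (HypCensus.cmPlace (L : Type) ι₁) 0 ∧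
    0 < HypCensus.cmXW (L : Type) (frameD V) (lineVec (L : Type) (dW' c.D 1)) (fun _ => dW'_real c.D 1) ι₁ (HypCensus.cmPlace (L : Type) ι₁) 0 :=
  fun V c hc =>
    ⟨(hpos_iff_eq_orientBitι_of_goodCtx_of_embedding_eq V hc.1 hc.2 0 (dW_real c.D 0)).2 rfl,
      (hpos_iff_eq_orientBitι_of_goodCtx_of_embedding_eq V hc.1 hc.2 1 (dW_real c.D 1)).2 rfl,
      (hpos_iff_eq_orientBitι_of_goodCtx_of_embedding_eq V hc.1 hc.2 2 (dW'_real c.D 0)).2 rfl,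
      (hpos_iff_eq_orientBitι_of_goodCtx_of_embedding_eq V hc.1 hc.2 3 (dW'_real c.D 1)).2 rfl⟩

/-- **THE ROW-5 PIN AT THE OG GUARD**: `SROG @hGR @χV @hGR₀..₃ @μ hΔ₁ hΔ₂ hΔ₃` — inputs [GR91 3.1.1]×5 (cited), `χV`, `μ` (data) and the
three GUARDED (J-μ) integer identities; `η`, `hη`, `hηc`, `hμ₀`, `hpos₀..₃`, `h₁W` all discharged. -/
abbrev SROG
    (hΔ₁ : ∀ {L : CMField} {ι₁ : L →+* ℂ} (V : HermSpace3 L ι₁) (c : SeesawCtx L), ∀ hc : GOG V c,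
      slotTypeVec V c (hGR V c) (hGR₀ V c) (hGR₁ V c) (hGR₂ V c) (hGR₃ V c) (hG_GOG V c hc) 1 -
        slotTypeVec V c (hGR V c) (hGR₀ V c) (hGR₁ V c) (hGR₂ V c) (hGR₃ V c) (hG_GOG V c hc) 0 = μ c 1 - μ c 0)
    (hΔ₂ : ∀ {L : CMField} {ι₁ : L →+* ℂ} (V : HermSpace3 L ι₁) (c : SeesawCtx L), ∀ hc : GOG V c,
      slotTypeVec V c (hGR V c) (hGR₀ V c) (hGR₁ V c) (hGR₂ V c) (hGR₃ V c) (hG_GOG V c hc) 2 -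
        slotTypeVec V c (hGR V c) (hGR₀ V c) (hGR₁ V c) (hGR₂ V c) (hGR₃ V c) (hG_GOG V c hc) 0 = μ c 2 - μ c 0)
    (hΔ₃ : ∀ {L : CMField} {ι₁ : L →+* ℂ} (V : HermSpace3 L ι₁) (c : SeesawCtx L), ∀ hc : GOG V c,
      slotTypeVec V c (hGR V c) (hGR₀ V c) (hGR₁ V c) (hGR₂ V c) (hGR₃ V c) (hG_GOG V c hc) 3 -
        slotTypeVec V c (hGR V c) (hGR₀ V c) (hGR₁ V c) (hGR₂ V c) (hGR₃ V c) (hG_GOG V c hc) 0 = μ c 3 - μ c 0) :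
    ∀ {L : CMField} {ι₁ : L →+* ℂ} (V : HermSpace3 L ι₁) (c : SeesawCtx L), ThetaAdelicSide V c :=
  SR @GOG @hG_GOG @hGR @χV @hGR₀ @hGR₁ @hGR₂ @hGR₃ @μ @hpos_GOG @hΔ₁ @hΔ₂ @hΔ₃

/-- **row 13 `hT` at the OG pin, hypothesis-free.** -/
theorem hT_ROG (hΔ₁ hΔ₂ hΔ₃) : ∀ {L : CMField} {ι₁ : L →+* ℂ} (V : HermSpace3 L ι₁) (c : SeesawCtx L) (k : Fin 4) (N : ℕ),
    ((SROG @hGR @χV @hGR₀ @hGR₁ @hGR₂ @hGR₃ @μ hΔ₁ hΔ₂ hΔ₃ V c).P k).IsThetaArchContinuous N :=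
  hT_R _ _ _ _ _ _ _ _ _ _ _ _ _

/-- `hLF` at the OG pin, hypothesis-free. -/
theorem hLF_ROG (hΔ₁ hΔ₂ hΔ₃) : ∀ {L : CMField} {ι₁ : L →+* ℂ} (V : HermSpace3 L ι₁) (c : SeesawCtx L) (k : Fin 4),
    ((SROG @hGR @χV @hGR₀ @hGR₁ @hGR₂ @hGR₃ @μ hΔ₁ hΔ₂ hΔ₃ V c).P k).IsLFAction :=
  hLF_R _ _ _ _ _ _ _ _ _ _ _ _ _

end HodgeCM.Model.SInstance

end
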